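import Literature.AlgebraicGeometry.HodgeTheory.WeilClasses
import Literature.AlgebraicGeometry.HodgeTheory.DegreeOneHodgeTypes
import HarnessLib

/-!
# Weil classes with respect to a subfield `F ⊂ End⁰(X)`: the Moonen–Zarhin Hodge criterion

Moonen–Zarhin, *Weil classes on abelian varieties* (Crelle 496 (1998) = arXiv:alg-geom/9612017),
§1: for an abelian variety `X` of dimension `g`, a subfield `F ⊂ End⁰(X)` with `1 ∈ F` acting as the
identity, `V_X = H¹(X, ℚ)`, `r = 2g/[F:ℚ]`, the one-dimensional `F`-vector space
`W_F := ⋀^r_F V_X ⊂ H^r(X, ℚ)` (Lemma (1)) is "the space of Weil classes with respect to `F`", and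
"`W_F ⊗ ℂ = (⋀^r_F V_X) ⊗ ℂ = ⋀^r_{F ⊗ ℂ} V_ℂ = ⊕_{σ ∈ Σ_F} ⋀^r_ℂ V_{ℂ,σ}
= ⊕_σ (⋀^{n_σ} V^{1,0}_{ℂ,σ} ⊗ ⋀^{n_σ′} V^{0,1}_{ℂ,σ})`", `n_σ = dim V^{1,0}_{ℂ,σ}` "the multiplicity of
`σ` on the tangent space of `X`; we have `n_σ + n_σ′ = 2g/[F:ℚ]`" (`σ′` = complex conjugate of `σ`),
whence the **Criterion**: "If `n_σ = n_σ′` for all `σ ∈ Σ_F` then `W_F` consists entirely of Hodge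
classes; if `n_σ ≠ n_σ′` for some `σ ∈ Σ_F` then the zero class is the only Hodge class in `W_F`."
(For `F` imaginary quadratic this is Weil's criterion, PROVED in the tree on the same carriers:
`isOfHodgeType_of_mem_weilClassesOf`, `finrank_eq_of_mem_weilClassesOf`, `WeilClassesHodgeType.lean`.)

## Rendering on the tree's real carriers (as `WeilClasses.lean`, `RankFourFaces`)

* The field is `F = ℚ(φ) ≅ ℚ[T]/(P)` for ONE endomorphism `φ : A ⟶ A` with `P(φ) = 0` in `End A`,
  `P ∈ ℤ[T]` monic, irreducible over `ℚ` of degree `e` (every subfield of `End⁰(X)` is `ℚ(θ)` for an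
  integral primitive element `θ ∈ End(X)`, and `ℚ[φ]` is a field exactly when the minimal
  polynomial is irreducible); `e · r = 2 dim A`; the embeddings `σ : F → ℂ` are the complex roots
  `ρ = σ(φ)` of `P`, `σ′ ↔ ρ̄ = starRingEnd ℂ ρ`.
* `V_{ℂ,σ} = ker(φ^* - ρ) ⊆ H¹(A(ℂ); ℂ)` (`Module.End.eigenspace` of `complexBetti.map φ 1`), and
  **`n_σ = eigenMultiplicity A φ ρ := dim_ℂ (ker(φ^* - ρ) ∩ H^{1,0}(A))`** (`hodgeOneZero`; the
  multiplicity on `H^{1,0} = (Lie X)^∨` equals that on the tangent space).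
* **`W_F ⊗ ℂ = weilClassesField A φ P r := ⨆_{P(ρ) = 0} pullbackEigenclasses A φ r ((x + yρ)^r)`**
  — VERBATIM the carrier of `Summit.HodgeConjecture.HodgeConjecture.Theses.RankFourFaces.
  RankFourWeilClasses` (`r = 4`): by the displayed formula `W_F ⊗ ℂ = ⊕_σ ⋀^r V_{ℂ,σ}`, and
  `⋀^r V_{ℂ,ρ} ⊆ H^r(A(ℂ); ℂ) = ⋀^r H¹` is exactly the simultaneous eigenspace of the test
  pull-backs `(x·𝟙 + y·φ)^*`, `x y : ℕ`, for the character `(x + yρ)^r` (on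
  `⋀^{a₁} V_{ρ₁} ⊗ ⋯ ⊗ ⋀^{a_e} V_{ρ_e}` they act by `Π (x + yρᵢ)^{aᵢ}`, and these polynomials in
  `(x, y)` are pairwise distinct since the `ρᵢ` are distinct — `P` is separable —; cf. the module
  docstring of `WeilClasses.lean` for `e = 2`).
* "consists of Hodge classes" = every class of `W_F ⊗ ℂ` is of Hodge type `(r/2, r/2)`
  (`IsOfHodgeType`, closed under `ℂ`-linear combinations); "the zero class is the only Hodge class
  in `W_F`" = a RATIONAL class (`IsRationalClass`) of `W_F ⊗ ℂ` of type `(r/2, r/2)` is `0`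
  (`(W_F ⊗ ℂ) ∩ H^r(X, ℚ) = W_F`). For odd `r` both readings are vacuous/automatic, as in print
  (`n_σ + n_σ′ = r`).

Deliberately NOT here: the norm/restriction relation for `F ⊂ F′` ("`W_F` is contained in the span of
exterior products of elements of `W_{F′}`", loc. cit. §2) and Criterion (4.?) on exceptional versus
decomposable classes — both need cup products of Weil classes of two different fields on the real
carriers; the identification `weilClassesField = W_F ⊗ ℂ` as a theorem (needs `H^*(A) = ⋀^* H¹`
with the `F`-structure over `ℚ`); Tate classes (§3).

## References

* B. J. J. Moonen, Yu. G. Zarhin, *Weil classes on abelian varieties*, J. reine angew. Math. 496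
  (1998), 83–92 = arXiv:alg-geom/9612017, §1: Lemma (1), the display `W_F ⊗ ℂ = ⊕_σ ⋀^r V_{ℂ,σ}`,
  Criterion, Remark (Weil, Ribet, [SZ1] for CM fields) [MoonenZarhin1998WeilClasses].
* B. van Geemen, *An introduction to the Hodge conjecture for abelian varieties*, LNM 1594 (1994),
  4.8–4.10 (the quadratic case) [vanGeemen1994HodgeAV].
* P. Deligne (notes by J. Milne), *Hodge cycles on abelian varieties*, LNM 900 (1982), §4,
  (4.3)–(4.4), Prop. 4.4 [Deligne1982HodgeCycles].
-/

noncomputable section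

open CategoryTheory

namespace Literature.AlgebraicGeometry.HodgeTheory

open Literature.AlgebraicTopology.SingularHomology

section HodgeTheory

variable (A : Motives.AbelianVariety ℂ) (φ : A ⟶ A)

/-- **The multiplicity `n_σ` of an eigenvalue on `H^{1,0}`**: for a complex abelian variety `A`, an
endomorphism `φ` and `ρ ∈ ℂ`, `eigenMultiplicity A φ ρ = dim_ℂ (ker(φ^* - ρ) ∩ H^{1,0}(A))`,
`φ^*` the pull-back on `H¹(A(ℂ); ℂ)` — Moonen–Zarhin's "dimension `n_σ` of `V^{1,0}_{ℂ,σ}` … the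
multiplicity of `σ` on the tangent space of `X`" for `ρ = σ(φ)` (the typing of
`finrank_eq_of_mem_weilClassesOf`, `WeilClassesHodgeType.lean`, at a general eigenvalue).
[cite: MoonenZarhin1998WeilClasses, §1 (the multiplicities n_σ)] -/
def eigenMultiplicity (ρ : ℂ) : ℕ :=
  Module.finrank ℂ ↥(Module.End.eigenspace (complexBetti.map φ.hom.hom.hom 1).hom ρ ⊓
    hodgeOneZero (show Motives.IsSmoothProjective A.dim A.X from
      Motives.AbelianVariety.isSmoothProjective_holds (A := A)))

/-- **The complexified space of Weil classes `W_F ⊗ ℂ ⊆ H^r(A(ℂ); ℂ)` with respect to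
`F = ℚ(φ) ≅ ℚ[T]/(P)`**, on the real carriers: the span over the complex roots `ρ` of `P` of the
simultaneous eigenclass spaces `pullbackEigenclasses A φ r ((x + yρ)^r)` (`= ⋀^r V_{ℂ,σ}`,
`σ(φ) = ρ`; Moonen–Zarhin: "`W_F ⊗ ℂ = ⊕_{σ ∈ Σ_F} ⋀^r_ℂ V_{ℂ,σ}`") — verbatim the carrier of the
route item `RankFourFaces.RankFourWeilClasses` (`r = 4`).
[cite: MoonenZarhin1998WeilClasses, §1 (W_F ⊗ ℂ = ⊕_σ ⋀^r V_{ℂ,σ})] -/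
def weilClassesField (P : Polynomial ℤ) (r : ℕ) : Submodule ℂ (complexBetti A.X r) :=
  ⨆ ρ ∈ {ρ : ℂ | Polynomial.eval₂ (Int.castRingHom ℂ) ρ P = 0},
    pullbackEigenclasses A φ r (fun x y => ((x : ℂ) + (y : ℂ) * ρ) ^ r)

variable {A φ}

/-- Membership in `weilClassesField`, in the literal shape of `RankFourFaces.RankFourWeilClasses`
(definitional). [cite: MoonenZarhin1998WeilClasses, §1] -/
theorem mem_weilClassesField_iff {P : Polynomial ℤ} {r : ℕ} {c : complexBetti A.X r} :
    c ∈ weilClassesField A φ P r ↔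
      c ∈ ⨆ ρ ∈ {ρ : ℂ | Polynomial.eval₂ (Int.castRingHom ℂ) ρ P = 0},
        pullbackEigenclasses A φ r (fun x y => ((x : ℂ) + (y : ℂ) * ρ) ^ r) :=
  Iff.rfl

/-- Each summand `⋀^r V_{ℂ,ρ}` lies in `W_F ⊗ ℂ`. [cite: MoonenZarhin1998WeilClasses, §1] -/
theorem pullbackEigenclasses_le_weilClassesField {P : Polynomial ℤ} {r : ℕ} {ρ : ℂ}
    (hρ : Polynomial.eval₂ (Int.castRingHom ℂ) ρ P = 0) :
    pullbackEigenclasses A φ r (fun x y => ((x : ℂ) + (y : ℂ) * ρ) ^ r) ≤ weilClassesField A φ P r :=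
  le_iSup₂_of_le (f := fun ρ (_ : ρ ∈ {ρ : ℂ | Polynomial.eval₂ (Int.castRingHom ℂ) ρ P = 0}) =>
    pullbackEigenclasses A φ r (fun x y => ((x : ℂ) + (y : ℂ) * ρ) ^ r)) ρ hρ le_rfl

/-- **Moonen–Zarhin's Hodge criterion for Weil classes** (NAMED FACT; Moonen–Zarhin 1998, §1,
Criterion — "If `n_σ = n_σ′` for all `σ ∈ Σ_F` then `W_F` consists entirely of Hodge classes; if
`n_σ ≠ n_σ′` for some `σ ∈ Σ_F` then the zero class is the only Hodge class in `W_F`"; the case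
`[F:ℚ] = 2` is Weil's, van Geemen 4.10, Deligne–Milne Prop. 4.4, proved in the tree as
`isOfHodgeType_of_mem_weilClassesOf` / `finrank_eq_of_mem_weilClassesOf`), on the real carriers
(module docstring): for a complex abelian variety `A`, `φ : A ⟶ A` with `P(φ) = 0` for a monic
`P ∈ ℤ[T]` irreducible over `ℚ` of degree `e` (so `F = ℚ(φ)` is a field of degree `e`), and `r`
with `e · r = 2 dim A`:
(i) if `n_ρ = n_ρ̄` for every complex root `ρ` of `P`, every class of `W_F ⊗ ℂ` is of Hodge type
`(r/2, r/2)`; (ii) if `n_ρ ≠ n_ρ̄` for some root `ρ`, every RATIONAL class of `W_F ⊗ ℂ` of Hodge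
type `(r/2, r/2)` is zero. [cite: MoonenZarhin1998WeilClasses, §1 (Criterion)] -/
def MoonenZarhin1998_weilClasses_hodgeCriterion : Prop :=
  ∀ (A : Motives.AbelianVariety ℂ) (φ : A ⟶ A) (P : Polynomial ℤ) (e r : ℕ),
    P.Monic → P.natDegree = e → Irreducible (P.map (Int.castRingHom ℚ)) →
    Polynomial.eval₂ (Int.castRingHom (CategoryTheory.End A)) (φ : CategoryTheory.End A) P = 0 →
    e * r = 2 * A.dim →
      ((∀ ρ : ℂ, Polynomial.eval₂ (Int.castRingHom ℂ) ρ P = 0 →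
          eigenMultiplicity A φ ρ = eigenMultiplicity A φ (starRingEnd ℂ ρ)) →
        ∀ c ∈ weilClassesField A φ P r, IsOfHodgeType A.dim A.X r (r / 2) (r / 2) c) ∧
      ((∃ ρ : ℂ, Polynomial.eval₂ (Int.castRingHom ℂ) ρ P = 0 ∧
          eigenMultiplicity A φ ρ ≠ eigenMultiplicity A φ (starRingEnd ℂ ρ)) →
        ∀ c ∈ weilClassesField A φ P r, IsRationalClass c →
          IsOfHodgeType A.dim A.X r (r / 2) (r / 2) c → c = 0)

/-- **Corollary (the shape consumed by `RankFourFaces.RankFourWeilClasses`, `r = 4`)**: under the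
criterion, a NON-ZERO rational `(r/2, r/2)`-class in `W_F ⊗ ℂ` forces the balanced condition
`n_ρ = n_ρ̄` at every root — so the hypothesis of that item is non-vacuous only on abelian varieties
of Weil type relative to `F`. [cite: MoonenZarhin1998WeilClasses, §1 (Criterion)] -/
theorem MoonenZarhin1998_weilClasses_hodgeCriterion.eigenMultiplicity_eq_of_ne_zero
    (h : MoonenZarhin1998_weilClasses_hodgeCriterion) {A : Motives.AbelianVariety ℂ} {φ : A ⟶ A}
    {P : Polynomial ℤ} {e r : ℕ} (hP : P.Monic) (hPe : P.natDegree = e)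
    (hPirr : Irreducible (P.map (Int.castRingHom ℚ)))
    (hφ : Polynomial.eval₂ (Int.castRingHom (CategoryTheory.End A)) (φ : CategoryTheory.End A) P = 0)
    (her : e * r = 2 * A.dim) {c : complexBetti A.X r} (hc : c ∈ weilClassesField A φ P r)
    (hcQ : IsRationalClass c) (hcH : IsOfHodgeType A.dim A.X r (r / 2) (r / 2) c) (hc0 : c ≠ 0)
    {ρ : ℂ} (hρ : Polynomial.eval₂ (Int.castRingHom ℂ) ρ P = 0) :
    eigenMultiplicity A φ ρ = eigenMultiplicity A φ (starRingEnd ℂ ρ) := by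
  by_contra hne
  exact hc0 ((h A φ P e r hP hPe hPirr hφ her).2 ⟨ρ, hρ, hne⟩ c hc hcQ hcH)

end HodgeTheory

end Literature.AlgebraicGeometry.HodgeTheory
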